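import Mathlib
import HarnessLib
import Summits.HubbardSuperconductivity.HubbardSuperconductivity.Theorems.DeformationLadderLowEnergyRigidityCurrentNeutral
import Literature.MathematicalPhysics.QuantumLattice.BdGBondHamiltonianTorus
import Literature.MathematicalPhysics.QuantumLattice.HubbardWave0LiebProofs

/-!
# Route `DeformationLadder` — crux `LowEnergyRigidity` (stmt-HubbardSuperconductivity-1892),
# crux idea `heavy-condensate-fibration`, item 4: only the interaction fails to conserve the current

Companion of `…CurrentNeutral` (where the total `e₁`-current
`𝒥 = Σ_{x,σ} (c†_{x+e₁,σ} c_{x,σ} - c†_{x,σ} c_{x+e₁,σ})` is shown to commute with every pair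
field and with the condensate operator). Here: `𝒥` commutes with the torus HOPPING
(`hcf_current_commute_hopping`, `L ≥ 3`: `[c†_{x+e₁}c_x, c†_y c_{y+eᵢ}]` is a difference of two
Kronecker terms, `LiebThm1.creation_mul_annihilation_commutator`, and the translation sum cancels
them after a shift `y ↦ y + e₁`), hence
`[𝒥, hubbardTorus 2 L t U] = U · [𝒥, Σ_x n_{x↑} n_{x↓}]` (`hcf_current_commutator_hubbardTorus`):
the card's "only `U Σ n↑n↓` fails to conserve `J_tot`", so that the paramagnetic screening of the
stiffness inside the `Π`-fibration is exactly second order in `U`.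
-/

namespace Summit.HubbardSuperconductivity.HubbardSuperconductivity.Theorems

set_option linter.dupNamespace false

open Literature.MathematicalPhysics.QuantumLattice Literature.Probability.LatticeModels Matrix Finset
open scoped ComplexOrder

section CurrentHopping

variable (L : ℕ) [NeZero L]

/-- **The translation sum kills the commutator of the current with a symmetrised bond hopping**:
for every axis `i` and spin `τ`, `Σ_y [𝒥, c†_{y,τ}c_{y+eᵢ,τ} + c†_{y+eᵢ,τ}c_{y,τ}] = 0`. [folklore] -/
theorem hcf_sum_commutator_current_bondHop (i τ : Fin 2) :
    ∑ y : TorusSite 2 L,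
      ((∑ x : TorusSite 2 L, ∑ σ : Fin 2,
        (creation (orb (FermionTorus.ofTorusSite (x + Pi.single 0 1)) σ) *
            annihilation (orb (FermionTorus.ofTorusSite x) σ) -
          creation (orb (FermionTorus.ofTorusSite x) σ) *
            annihilation (orb (FermionTorus.ofTorusSite (x + Pi.single 0 1)) σ))) *
          ((creation (orb (FermionTorus.ofTorusSite (y)) τ) * annihilation (orb (FermionTorus.ofTorusSite (y + Pi.single i 1)) τ)) + (creation (orb (FermionTorus.ofTorusSite (y + Pi.single i 1)) τ) * annihilation (orb (FermionTorus.ofTorusSite (y)) τ))) -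
        ((creation (orb (FermionTorus.ofTorusSite (y)) τ) * annihilation (orb (FermionTorus.ofTorusSite (y + Pi.single i 1)) τ)) + (creation (orb (FermionTorus.ofTorusSite (y + Pi.single i 1)) τ) * annihilation (orb (FermionTorus.ofTorusSite (y)) τ))) *
          (∑ x : TorusSite 2 L, ∑ σ : Fin 2,
        (creation (orb (FermionTorus.ofTorusSite (x + Pi.single 0 1)) σ) *
            annihilation (orb (FermionTorus.ofTorusSite x) σ) -
          creation (orb (FermionTorus.ofTorusSite x) σ) *
            annihilation (orb (FermionTorus.ofTorusSite (x + Pi.single 0 1)) σ)))) = 0 := by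
  set e₁ : TorusSite 2 L := Pi.single 0 1 with he₁
  set eᵢ : TorusSite 2 L := Pi.single i 1 with heᵢ
  -- the `gl`-commutator of two hoppings, with this file's decidability instances
  have gl : ∀ a b p q : Orb (FermionTorus 2 L),
      creation a * annihilation b * (creation p * annihilation q) -
          creation p * annihilation q * (creation a * annihilation b) =
        (if b = p then creation a * annihilation q else 0) -
          (if a = q then creation p * annihilation b else 0) := fun a b p q => by
    convert LiebThm1.creation_mul_annihilation_commutator a b p q
  -- one current term against one hopping monomial `c†_p c_q`, `p = (u,τ)`, `q = (v,τ)`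
  have hA : ∀ (x u v : TorusSite 2 L) (σ : Fin 2),
      creation (orb (FermionTorus.ofTorusSite (x + e₁)) σ) * annihilation (orb (FermionTorus.ofTorusSite (x)) σ) * (creation (orb (FermionTorus.ofTorusSite (u)) τ) * annihilation (orb (FermionTorus.ofTorusSite (v)) τ)) -
          creation (orb (FermionTorus.ofTorusSite (u)) τ) * annihilation (orb (FermionTorus.ofTorusSite (v)) τ) * (creation (orb (FermionTorus.ofTorusSite (x + e₁)) σ) * annihilation (orb (FermionTorus.ofTorusSite (x)) σ)) =
        (if orb (FermionTorus.ofTorusSite (x + 0)) σ = orb (FermionTorus.ofTorusSite u) τ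
            then creation (orb (FermionTorus.ofTorusSite (x + e₁)) σ) * annihilation (orb (FermionTorus.ofTorusSite (v)) τ) else 0) -
          (if orb (FermionTorus.ofTorusSite (x + e₁)) σ = orb (FermionTorus.ofTorusSite v) τ
            then creation (orb (FermionTorus.ofTorusSite (u)) τ) * annihilation (orb (FermionTorus.ofTorusSite (x)) σ) else 0) := fun x u v σ => by
    rw [add_zero]; exact gl _ _ _ _
  have hB : ∀ (x u v : TorusSite 2 L) (σ : Fin 2),
      creation (orb (FermionTorus.ofTorusSite (x)) σ) * annihilation (orb (FermionTorus.ofTorusSite (x + e₁)) σ) * (creation (orb (FermionTorus.ofTorusSite (u)) τ) * annihilation (orb (FermionTorus.ofTorusSite (v)) τ)) -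
          creation (orb (FermionTorus.ofTorusSite (u)) τ) * annihilation (orb (FermionTorus.ofTorusSite (v)) τ) * (creation (orb (FermionTorus.ofTorusSite (x)) σ) * annihilation (orb (FermionTorus.ofTorusSite (x + e₁)) σ)) =
        (if orb (FermionTorus.ofTorusSite (x + e₁)) σ = orb (FermionTorus.ofTorusSite u) τ
            then creation (orb (FermionTorus.ofTorusSite (x)) σ) * annihilation (orb (FermionTorus.ofTorusSite (v)) τ) else 0) -
          (if orb (FermionTorus.ofTorusSite (x + 0)) σ = orb (FermionTorus.ofTorusSite v) τ
            then creation (orb (FermionTorus.ofTorusSite (u)) τ) * annihilation (orb (FermionTorus.ofTorusSite (x + e₁)) σ) else 0) := fun x u v σ => by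
    rw [add_zero]; exact gl _ _ _ _
  -- the whole current against one hopping monomial
  have hJ : ∀ u v : TorusSite 2 L,
      (∑ x : TorusSite 2 L, ∑ σ : Fin 2, (creation (orb (FermionTorus.ofTorusSite (x + e₁)) σ) * annihilation (orb (FermionTorus.ofTorusSite (x)) σ) - creation (orb (FermionTorus.ofTorusSite (x)) σ) * annihilation (orb (FermionTorus.ofTorusSite (x + e₁)) σ))) *
          (creation (orb (FermionTorus.ofTorusSite (u)) τ) * annihilation (orb (FermionTorus.ofTorusSite (v)) τ)) -
        creation (orb (FermionTorus.ofTorusSite (u)) τ) * annihilation (orb (FermionTorus.ofTorusSite (v)) τ) *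
          (∑ x : TorusSite 2 L, ∑ σ : Fin 2, (creation (orb (FermionTorus.ofTorusSite (x + e₁)) σ) * annihilation (orb (FermionTorus.ofTorusSite (x)) σ) - creation (orb (FermionTorus.ofTorusSite (x)) σ) * annihilation (orb (FermionTorus.ofTorusSite (x + e₁)) σ))) =
        (creation (orb (FermionTorus.ofTorusSite (u + e₁)) τ) * annihilation (orb (FermionTorus.ofTorusSite (v)) τ) - creation (orb (FermionTorus.ofTorusSite (u)) τ) * annihilation (orb (FermionTorus.ofTorusSite (v - e₁)) τ)) -
          (creation (orb (FermionTorus.ofTorusSite (u - e₁)) τ) * annihilation (orb (FermionTorus.ofTorusSite (v)) τ) - creation (orb (FermionTorus.ofTorusSite (u)) τ) * annihilation (orb (FermionTorus.ofTorusSite (v + e₁)) τ)) := by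
    intro u v
    rw [Finset.sum_mul, Finset.mul_sum, ← Finset.sum_sub_distrib]
    have hin : ∀ x : TorusSite 2 L,
        (∑ σ : Fin 2, (creation (orb (FermionTorus.ofTorusSite (x + e₁)) σ) * annihilation (orb (FermionTorus.ofTorusSite (x)) σ) - creation (orb (FermionTorus.ofTorusSite (x)) σ) * annihilation (orb (FermionTorus.ofTorusSite (x + e₁)) σ))) *
            (creation (orb (FermionTorus.ofTorusSite (u)) τ) * annihilation (orb (FermionTorus.ofTorusSite (v)) τ)) -
          creation (orb (FermionTorus.ofTorusSite (u)) τ) * annihilation (orb (FermionTorus.ofTorusSite (v)) τ) *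
            ∑ σ : Fin 2, (creation (orb (FermionTorus.ofTorusSite (x + e₁)) σ) * annihilation (orb (FermionTorus.ofTorusSite (x)) σ) - creation (orb (FermionTorus.ofTorusSite (x)) σ) * annihilation (orb (FermionTorus.ofTorusSite (x + e₁)) σ)) =
        ∑ σ : Fin 2, ((creation (orb (FermionTorus.ofTorusSite (x + e₁)) σ) * annihilation (orb (FermionTorus.ofTorusSite (x)) σ) * (creation (orb (FermionTorus.ofTorusSite (u)) τ) * annihilation (orb (FermionTorus.ofTorusSite (v)) τ)) -
            creation (orb (FermionTorus.ofTorusSite (u)) τ) * annihilation (orb (FermionTorus.ofTorusSite (v)) τ) * (creation (orb (FermionTorus.ofTorusSite (x + e₁)) σ) * annihilation (orb (FermionTorus.ofTorusSite (x)) σ))) -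
          (creation (orb (FermionTorus.ofTorusSite (x)) σ) * annihilation (orb (FermionTorus.ofTorusSite (x + e₁)) σ) * (creation (orb (FermionTorus.ofTorusSite (u)) τ) * annihilation (orb (FermionTorus.ofTorusSite (v)) τ)) -
            creation (orb (FermionTorus.ofTorusSite (u)) τ) * annihilation (orb (FermionTorus.ofTorusSite (v)) τ) * (creation (orb (FermionTorus.ofTorusSite (x)) σ) * annihilation (orb (FermionTorus.ofTorusSite (x + e₁)) σ)))) := by
      intro x
      rw [Finset.sum_mul, Finset.mul_sum, ← Finset.sum_sub_distrib]
      refine Finset.sum_congr rfl fun σ _ => ?_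
      noncomm_ring
    simp_rw [hin, hA, hB, Finset.sum_sub_distrib]
    rw [hcf_sum_sum_ite_orb_eq, hcf_sum_sum_ite_orb_eq, hcf_sum_sum_ite_orb_eq, hcf_sum_sum_ite_orb_eq,
      sub_zero, sub_zero]
  -- split the symmetrised hopping, apply `hJ` with `(u,v) = (y, y+eᵢ)` and `(y+eᵢ, y)`
  have hsplit : ∀ y : TorusSite 2 L,
      (∑ x : TorusSite 2 L, ∑ σ : Fin 2,
        (creation (orb (FermionTorus.ofTorusSite (x + e₁)) σ) *
            annihilation (orb (FermionTorus.ofTorusSite x) σ) -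
          creation (orb (FermionTorus.ofTorusSite x) σ) *
            annihilation (orb (FermionTorus.ofTorusSite (x + e₁)) σ))) * ((creation (orb (FermionTorus.ofTorusSite (y)) τ) * annihilation (orb (FermionTorus.ofTorusSite (y + eᵢ)) τ)) + (creation (orb (FermionTorus.ofTorusSite (y + eᵢ)) τ) * annihilation (orb (FermionTorus.ofTorusSite (y)) τ))) -
        ((creation (orb (FermionTorus.ofTorusSite (y)) τ) * annihilation (orb (FermionTorus.ofTorusSite (y + eᵢ)) τ)) + (creation (orb (FermionTorus.ofTorusSite (y + eᵢ)) τ) * annihilation (orb (FermionTorus.ofTorusSite (y)) τ))) * (∑ x : TorusSite 2 L, ∑ σ : Fin 2,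
        (creation (orb (FermionTorus.ofTorusSite (x + e₁)) σ) *
            annihilation (orb (FermionTorus.ofTorusSite x) σ) -
          creation (orb (FermionTorus.ofTorusSite x) σ) *
            annihilation (orb (FermionTorus.ofTorusSite (x + e₁)) σ))) =
      ((∑ x : TorusSite 2 L, ∑ σ : Fin 2, (creation (orb (FermionTorus.ofTorusSite (x + e₁)) σ) * annihilation (orb (FermionTorus.ofTorusSite (x)) σ) - creation (orb (FermionTorus.ofTorusSite (x)) σ) * annihilation (orb (FermionTorus.ofTorusSite (x + e₁)) σ))) *
          (creation (orb (FermionTorus.ofTorusSite (y)) τ) * annihilation (orb (FermionTorus.ofTorusSite (y + eᵢ)) τ)) -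
        creation (orb (FermionTorus.ofTorusSite (y)) τ) * annihilation (orb (FermionTorus.ofTorusSite (y + eᵢ)) τ) *
          (∑ x : TorusSite 2 L, ∑ σ : Fin 2, (creation (orb (FermionTorus.ofTorusSite (x + e₁)) σ) * annihilation (orb (FermionTorus.ofTorusSite (x)) σ) - creation (orb (FermionTorus.ofTorusSite (x)) σ) * annihilation (orb (FermionTorus.ofTorusSite (x + e₁)) σ)))) +
      ((∑ x : TorusSite 2 L, ∑ σ : Fin 2, (creation (orb (FermionTorus.ofTorusSite (x + e₁)) σ) * annihilation (orb (FermionTorus.ofTorusSite (x)) σ) - creation (orb (FermionTorus.ofTorusSite (x)) σ) * annihilation (orb (FermionTorus.ofTorusSite (x + e₁)) σ))) *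
          (creation (orb (FermionTorus.ofTorusSite (y + eᵢ)) τ) * annihilation (orb (FermionTorus.ofTorusSite (y)) τ)) -
        creation (orb (FermionTorus.ofTorusSite (y + eᵢ)) τ) * annihilation (orb (FermionTorus.ofTorusSite (y)) τ) *
          (∑ x : TorusSite 2 L, ∑ σ : Fin 2, (creation (orb (FermionTorus.ofTorusSite (x + e₁)) σ) * annihilation (orb (FermionTorus.ofTorusSite (x)) σ) - creation (orb (FermionTorus.ofTorusSite (x)) σ) * annihilation (orb (FermionTorus.ofTorusSite (x + e₁)) σ)))) := by
    intro y
    noncomm_ring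
  simp_rw [hsplit, hJ]
  rw [Finset.sum_add_distrib, Finset.sum_sub_distrib, Finset.sum_sub_distrib, Finset.sum_sub_distrib,
    Finset.sum_sub_distrib, Finset.sum_sub_distrib, Finset.sum_sub_distrib]
  -- the four translation identities (shift `y ↦ y + e₁`)
  have s1 : ∑ y : TorusSite 2 L, creation (orb (FermionTorus.ofTorusSite (y)) τ) * annihilation (orb (FermionTorus.ofTorusSite (y + eᵢ - e₁)) τ) =
      ∑ y : TorusSite 2 L, creation (orb (FermionTorus.ofTorusSite (y + e₁)) τ) * annihilation (orb (FermionTorus.ofTorusSite (y + eᵢ)) τ) := by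
    refine Fintype.sum_equiv (Equiv.subRight e₁) _ _ fun y => ?_
    simp only [Equiv.subRight_apply]
    congr 3
    all_goals abel_nf
  have s2 : ∑ y : TorusSite 2 L, creation (orb (FermionTorus.ofTorusSite (y)) τ) * annihilation (orb (FermionTorus.ofTorusSite (y + eᵢ + e₁)) τ) =
      ∑ y : TorusSite 2 L, creation (orb (FermionTorus.ofTorusSite (y - e₁)) τ) * annihilation (orb (FermionTorus.ofTorusSite (y + eᵢ)) τ) := by
    refine Fintype.sum_equiv (Equiv.addRight e₁) _ _ fun y => ?_
    simp only [Equiv.coe_addRight]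
    congr 3
    all_goals abel_nf
  have s3 : ∑ y : TorusSite 2 L, creation (orb (FermionTorus.ofTorusSite (y + eᵢ)) τ) * annihilation (orb (FermionTorus.ofTorusSite (y - e₁)) τ) =
      ∑ y : TorusSite 2 L, creation (orb (FermionTorus.ofTorusSite (y + eᵢ + e₁)) τ) * annihilation (orb (FermionTorus.ofTorusSite (y)) τ) := by
    refine Fintype.sum_equiv (Equiv.subRight e₁) _ _ fun y => ?_
    simp only [Equiv.subRight_apply]
    congr 3
    all_goals abel_nf
  have s4 : ∑ y : TorusSite 2 L, creation (orb (FermionTorus.ofTorusSite (y + eᵢ)) τ) * annihilation (orb (FermionTorus.ofTorusSite (y + e₁)) τ) =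
      ∑ y : TorusSite 2 L, creation (orb (FermionTorus.ofTorusSite (y + eᵢ - e₁)) τ) * annihilation (orb (FermionTorus.ofTorusSite (y)) τ) := by
    refine Fintype.sum_equiv (Equiv.addRight e₁) _ _ fun y => ?_
    simp only [Equiv.coe_addRight]
    congr 3
    all_goals abel_nf
  rw [s1, s2, s3, s4]
  abel

/-- **The current commutes with the torus hopping** (`L ≥ 3`, so that the four neighbours of a site
are distinct and the hopping is the directed-bond sum `Σ_{x,i,σ} (c†_{x,σ}c_{x+eᵢ,σ} + h.c.)`,
`hubbard_hopping_torus_eq_sum_torusBondHop`). In momentum space: both are diagonal. [folklore] -/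
theorem hcf_current_commute_hopping (hL : 3 ≤ L) :
    Commute (∑ x : TorusSite 2 L, ∑ σ : Fin 2,
        (creation (orb (FermionTorus.ofTorusSite (x + Pi.single 0 1)) σ) *
            annihilation (orb (FermionTorus.ofTorusSite x) σ) -
          creation (orb (FermionTorus.ofTorusSite x) σ) *
            annihilation (orb (FermionTorus.ofTorusSite (x + Pi.single 0 1)) σ)))
      (∑ X : FermionTorus 2 L, ∑ Y : FermionTorus 2 L, ∑ σ : Fin 2,
        if (fermionTorusGraph 2 L).Adj X Y then creation (orb X σ) * annihilation (orb Y σ) else 0) := by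
  rw [hubbard_hopping_torus_eq_sum_torusBondHop L hL, Commute, SemiconjBy, ← sub_eq_zero]
  -- reorder the hopping sum as `Σ_i Σ_σ Σ_x`
  have hre : (∑ x : TorusSite 2 L, ∑ i : Fin 2, ∑ σ : Fin 2, (torusBondHop L x i σ + (torusBondHop L x i σ)ᴴ)) =
      ∑ i : Fin 2, ∑ σ : Fin 2, ∑ x : TorusSite 2 L, (torusBondHop L x i σ + (torusBondHop L x i σ)ᴴ) := by
    rw [Finset.sum_comm]
    refine Finset.sum_congr rfl fun i _ => ?_
    rw [Finset.sum_comm]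
  rw [hre, Finset.mul_sum, Finset.sum_mul, ← Finset.sum_sub_distrib]
  refine Finset.sum_eq_zero fun i _ => ?_
  rw [Finset.mul_sum, Finset.sum_mul, ← Finset.sum_sub_distrib]
  refine Finset.sum_eq_zero fun σ _ => ?_
  rw [Finset.mul_sum, Finset.sum_mul, ← Finset.sum_sub_distrib]
  simp only [torusBondHop, conjTranspose_mul, creation_conjTranspose, annihilation_conjTranspose]
  exact hcf_sum_commutator_current_bondHop L i σ

/-- **Only the interaction fails to conserve the current** (card `heavy-condensate-fibration`,
item 4): for the torus Hubbard Hamiltonian `H = -t·(hopping) + U Σ_x n_{x↑}n_{x↓}` (`L ≥ 3`),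
`[𝒥, H] = U · [𝒥, Σ_x n_{x↑} n_{x↓}]` — the commutator of the total current with `H` is EXACTLY
first order in `U`, with the local operator `F = [𝒥, Σ n↑n↓]`; combined with `[𝒥, Π_L] = 0`
(`hcf_current_commute_condOp`) this is the input of the card's `O(U²)` paramagnetic identity.
[folklore] -/
theorem hcf_current_commutator_hubbardTorus (hL : 3 ≤ L) (t U : ℝ) :
    (∑ x : TorusSite 2 L, ∑ σ : Fin 2,
        (creation (orb (FermionTorus.ofTorusSite (x + Pi.single 0 1)) σ) *
            annihilation (orb (FermionTorus.ofTorusSite x) σ) -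
          creation (orb (FermionTorus.ofTorusSite x) σ) *
            annihilation (orb (FermionTorus.ofTorusSite (x + Pi.single 0 1)) σ))) * hubbardTorus 2 L t U - hubbardTorus 2 L t U * (∑ x : TorusSite 2 L, ∑ σ : Fin 2,
        (creation (orb (FermionTorus.ofTorusSite (x + Pi.single 0 1)) σ) *
            annihilation (orb (FermionTorus.ofTorusSite x) σ) -
          creation (orb (FermionTorus.ofTorusSite x) σ) *
            annihilation (orb (FermionTorus.ofTorusSite (x + Pi.single 0 1)) σ))) =
      (U : ℂ) • ((∑ x : TorusSite 2 L, ∑ σ : Fin 2,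
        (creation (orb (FermionTorus.ofTorusSite (x + Pi.single 0 1)) σ) *
            annihilation (orb (FermionTorus.ofTorusSite x) σ) -
          creation (orb (FermionTorus.ofTorusSite x) σ) *
            annihilation (orb (FermionTorus.ofTorusSite (x + Pi.single 0 1)) σ))) * (∑ x : FermionTorus 2 L, numberOp x 0 * numberOp x 1) -
        (∑ x : FermionTorus 2 L, numberOp x 0 * numberOp x 1) * (∑ x : TorusSite 2 L, ∑ σ : Fin 2,
        (creation (orb (FermionTorus.ofTorusSite (x + Pi.single 0 1)) σ) *
            annihilation (orb (FermionTorus.ofTorusSite x) σ) -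
          creation (orb (FermionTorus.ofTorusSite x) σ) *
            annihilation (orb (FermionTorus.ofTorusSite (x + Pi.single 0 1)) σ)))) := by
  have h := hcf_current_commute_hopping L hL
  rw [Commute, SemiconjBy] at h
  rw [hubbardTorus, hamiltonian, mul_add, add_mul, mul_smul_comm, smul_mul_assoc, mul_smul_comm,
    smul_mul_assoc, h]
  rw [smul_sub]
  abel

end CurrentHopping

end Summit.HubbardSuperconductivity.HubbardSuperconductivity.Theorems
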